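import Summits.QuantumFields.BalabanUV.Beta.FP.ConstrainedBiLaplacianKernel
import Literature.MathematicalPhysics.QuantumFieldTheory.Balaban1983to89.B5HkUniformL2Zd

/-!
# `BalabanUV.Beta.FP.ConstrainedBiLaplacianParseval` — road «FP» for binder row D1, row **RHOA-4-GH (localisation half)**, the n-UNIFORM
# currency: FILE 4a — THE TWISTED BOX DFT OF OFFSET VECTORS (`Adft`, `Bdft` against the sub-lattice phases `EF`, `EFc` of FILE 3b) HAS
# `ℓ²` MASS `≤ n^d·4^d·‖f‖₂²` ON THE FAT REGION — root-of-unity orthogonality on `{0..n−1}^d` and Parseval, the `p′`-twist costing `≤ 2^d`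

NOT IN PRINT; OUR PROOF ATTEMPT (binder row G-an2-4 ∕ (CONV-C), prover part P3, fibre∕strip lineage).  HONEST DEPENDENCY (cell records,
verbatim): «continuum YM on T⁴ ⇐ BetaPertH ∧ nine spine estimates (0/9 proved); BetaPertH ⇐ (D1) ∧ (D4) ∧ CAP+tail; G-an2-4 gates asym, D1
and NE2/3/4.»  HONEST FRAMING (cell contract, verbatim): «discharging `BetaPertH` makes Bałaban's UV stability UNCONDITIONAL — a real
constructive-QFT result; it is NOT the continuum limit and NOT the Clay problem.»  ABSOLUTE RULE (cell charter, verbatim): «No internally-minted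
statement may enter as a cited fact. Every hypothesis is either kernel-proved in this package or a verbatim quotation of a PUBLISHED theorem with
page reference. The manuscript(s) under audit are NOT citable for their own disputed steps — they are the thing under adjudication;
programme-internal (2001/route/tribunal) claims are never citable.»  THIS MODULE is [folklore] finite Fourier analysis + Cauchy–Schwarz; no symbol of [B4] is re-defined, nothing is cited as a hypothesis, no
`def … : Prop`, no `sorry`.

## Why (the located prefactor of FILE 3b, repaired in the right norm — plan of FILES 4a∕4b∕4c)

FILE 3b's ENTRYWISE bound carries the diagonal alias weight `Lam = Σ_{k≠0}((64∕7)∕W_k)^s ≍ log n` at `(s, d) = (2, 4)` — truly so.  Paired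
against offset vectors `f, g : {0..n−1}^d → ℂ`, the multiplier `Φ_{f,g} = Σ_{τσ} conj(f τ)·g σ·M n s τ σ = n^{−d} Σ_{kk′} A_k B_{k′} Gfib_{kk′}` with
the TWISTED BOX DFTs `A_k = Σ_τ conj(f τ)·EF(τ,k)` (`Adft`), `B_{k′} = Σ_σ g σ·EFc(σ,k′)` (`Bdft`).  THIS FILE: `EF = twist·chi`, `EFc = twistc·conj chi`
with the box characters `chi k τ = Π_ν e^{2πik_ντ_ν∕n}` (orthogonal: `sum_chi_mul_conj_chi`), PARSEVAL `Σ_k‖Σ_τ c_τ chi k τ‖² = n^dΣ_τ‖c_τ‖²`, and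
the twists bounded by `2^d` on the fat region ⟹ **`sqNorm_Adft_le`**, **`sqNorm_Bdft_le`**: `Σ_k‖A_k‖² ≤ n^d·4^d·sqNorm f`.  FILE 4b
(`ConstrainedBiLaplacianFibreOperator`) bounds the alias-fibre matrix as an OPERATOR n-uniformly; FILE 4c (`ConstrainedBiLaplacianPairing`) assembles
`‖Φ_{f,g}‖ ≤ 4^d·Kop·‖f‖₂‖g‖₂` (the `n^{−d}` of `M` against the `n^d` of Parseval) and the n-UNIFORM block-pair decay.

## Contents

* §1 `sqNorm`, `norm_sum_mul_le`, `norm_sum_mul_mul_le` (finite Cauchy–Schwarz; the real square-root form is `B5HkUniformL2Zd.sum_mul_le_sqrt_mul_sqrt` BY NAME).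
* §2 `rootChar` (`e^{2πijt∕n}`), `int_eq_zero_of_exp_eq_one`, **`sum_rootChar`** (root-of-unity orthogonality), `chi`, **`sum_chi_mul_conj_chi`**,
  **`parseval_chi`**, `EF_eq_twist_mul_chi`, `EFc_eq_twist_mul_conj_chi`, `norm_twist_le`∕`norm_twistc_le`, `Adft`, `Bdft`, **`sqNorm_Adft_le`**,
  **`sqNorm_Bdft_le`**.

0∕4 row-D1 binders touched.  NOT RHOA-4-GH, NOT hbook, NOT D1, NOT BetaPertH, NOT continuum, NOT Clay.  Provenance: prover-b2b-balaban-gan24-p3-g21-0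
(unit `b2b-balaban-gan24-p3`, gen 21; R-FP-29 ∕ R-FP-33 (b)), 2026-08-21.
-/

noncomputable section

namespace Summit.QuantumFields.BalabanUV.Beta.FP.ConstrainedBiLaplacianParseval

open Complex Finset ComplexConjugate
open Literature.MathematicalPhysics.QuantumFieldTheory.Balaban1983to89
open Literature.MathematicalPhysics.QuantumFieldTheory.Balaban1983to89.B4Strip
open Literature.MathematicalPhysics.QuantumFieldTheory.Balaban1983to89.B4StripCauchy
open Literature.MathematicalPhysics.QuantumFieldTheory.Balaban1983to89.B5Strip145Analytic
open Literature.MathematicalPhysics.QuantumFieldTheory.Balaban1983to89.B4StripSums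
open Summit.QuantumFields.BalabanUV.Beta.FP.ConstrainedBiLaplacianStrip
open Summit.QuantumFields.BalabanUV.Beta.FP.ConstrainedBiLaplacianFibre
open Summit.QuantumFields.BalabanUV.Beta.FP.ConstrainedBiLaplacianFibreEntries
open Summit.QuantumFields.BalabanUV.Beta.FP.ConstrainedBiLaplacianFibreSides
open Summit.QuantumFields.BalabanUV.Beta.FP.ConstrainedBiLaplacianKernel
open scoped Real
open Literature.MathematicalPhysics.QuantumFieldTheory.Balaban1983to89.B5HkUniformL2Zd (sum_mul_le_sqrt_mul_sqrt)

variable {d : ℕ}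

/-! ## §1 Square norms and Cauchy–Schwarz -/

/-- [folklore] `sqNorm f = Σ_τ ‖f τ‖²` (the square of the `ℓ²` norm of an offset vector ∕ alias vector). -/
def sqNorm {ι : Type*} [Fintype ι] (f : ι → ℂ) : ℝ := ∑ i, ‖f i‖ ^ 2

/-- [folklore] `0 ≤ sqNorm f`. -/
theorem sqNorm_nonneg {ι : Type*} [Fintype ι] (f : ι → ℂ) : 0 ≤ sqNorm f := Finset.sum_nonneg fun _ _ => sq_nonneg _

/-- [folklore] `‖Σ_k x_k y_k‖ ≤ √(sqNorm x)·√(sqNorm y)`. -/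
theorem norm_sum_mul_le {ι : Type*} [Fintype ι] (x y : ι → ℂ) :
    ‖∑ k, x k * y k‖ ≤ Real.sqrt (sqNorm x) * Real.sqrt (sqNorm y) := by
  calc ‖∑ k, x k * y k‖ ≤ ∑ k, ‖x k * y k‖ := norm_sum_le _ _
    _ = ∑ k, ‖x k‖ * ‖y k‖ := Finset.sum_congr rfl fun k _ => norm_mul _ _
    _ ≤ Real.sqrt (∑ k, ‖x k‖ ^ 2) * Real.sqrt (∑ k, ‖y k‖ ^ 2) := sum_mul_le_sqrt_mul_sqrt _ _ _

/-- [folklore] A weighted Cauchy–Schwarz: `‖Σ_k x_k y_k D_k‖ ≤ D·√(sqNorm x)·√(sqNorm y)` if `‖D_k‖ ≤ D`. -/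
theorem norm_sum_mul_mul_le {ι : Type*} [Fintype ι] (x y D : ι → ℂ) {Dm : ℝ} (hD0 : 0 ≤ Dm) (hD : ∀ k, ‖D k‖ ≤ Dm) :
    ‖∑ k, x k * y k * D k‖ ≤ Dm * (Real.sqrt (sqNorm x) * Real.sqrt (sqNorm y)) := by
  calc ‖∑ k, x k * y k * D k‖ ≤ ∑ k, ‖x k * y k * D k‖ := norm_sum_le _ _
    _ ≤ ∑ k, Dm * (‖x k‖ * ‖y k‖) := Finset.sum_le_sum fun k _ => by
        rw [norm_mul, norm_mul]
        calc ‖x k‖ * ‖y k‖ * ‖D k‖ ≤ ‖x k‖ * ‖y k‖ * Dm := mul_le_mul_of_nonneg_left (hD k) (by positivity)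
          _ = Dm * (‖x k‖ * ‖y k‖) := by ring
    _ = Dm * ∑ k, ‖x k‖ * ‖y k‖ := by rw [Finset.mul_sum]
    _ ≤ Dm * (Real.sqrt (sqNorm x) * Real.sqrt (sqNorm y)) :=
        mul_le_mul_of_nonneg_left (sum_mul_le_sqrt_mul_sqrt _ _ _) hD0

/-! ## §2 The box characters and Parseval -/

/-- [folklore] The one-coordinate character `e^{2πi j t∕n}`. -/
def rootChar (n : ℕ) (j t : ℕ) : ℂ := cexp (2 * π * I * ((j : ℂ) * (t : ℂ)) / n)

/-- [folklore] `e^{2πi j t∕n} = ζ^j` with `ζ = e^{2πi t∕n}`. -/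
theorem rootChar_eq_pow (n j t : ℕ) : rootChar n j t = cexp (2 * π * I * (t : ℂ) / n) ^ j := by
  unfold rootChar
  rw [← Complex.exp_nat_mul]
  congr 1
  ring

/-- [folklore] `‖rootChar‖ = 1`. -/
theorem norm_rootChar (n j t : ℕ) : ‖rootChar n j t‖ = 1 := by
  unfold rootChar
  rw [Complex.norm_exp]
  have : (2 * π * I * ((j : ℂ) * (t : ℂ)) / n).re = 0 := by
    simp [Complex.mul_re, Complex.mul_im, Complex.div_re]
  rw [this, Real.exp_zero]

/-- [folklore] `conj (rootChar n j t) = (rootChar n j t)⁻¹`. -/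
theorem conj_rootChar (n j t : ℕ) : conj (rootChar n j t) = (rootChar n j t)⁻¹ := by
  rw [Complex.inv_def, ← Complex.norm_mul_self_eq_normSq, norm_rootChar]
  simp

/-- [folklore] `e^{z} = 1` with `z = 2πi·r∕n`, `r ∈ ℤ`, `|r| < n` forces `r = 0`. -/
theorem int_eq_zero_of_exp_eq_one (n : ℕ) [NeZero n] {r : ℤ} (hr : -(n : ℤ) < r ∧ r < n)
    (h1 : cexp (2 * π * I * (r : ℂ) / n) = 1) : r = 0 := by
  have hn : (n : ℂ) ≠ 0 := Nat.cast_ne_zero.mpr (NeZero.ne n)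
  have h2 : (2 * (π : ℂ) * I) ≠ 0 := by simp [Real.pi_ne_zero, Complex.I_ne_zero]
  obtain ⟨m, hm⟩ := Complex.exp_eq_one_iff.mp h1
  rw [div_eq_iff hn] at hm
  have h3 : (2 * (π : ℂ) * I) * ((r : ℂ) - m * n) = 0 := by linear_combination hm
  rcases mul_eq_zero.mp h3 with h4 | h4
  · exact absurd h4 h2
  · have hint : r = m * n := by exact_mod_cast (sub_eq_zero.mp h4)
    rcases lt_trichotomy m 0 with hneg | h0 | hpos
    · have : m * (n : ℤ) ≤ -(n : ℤ) := by nlinarith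
      omega
    · rw [hint, h0, zero_mul]
    · have : (n : ℤ) ≤ m * n := by nlinarith
      omega

/-- [folklore] **ROOT-OF-UNITY ORTHOGONALITY** in one coordinate: for `t, t′ < n`,
`Σ_{j<n} e^{2πij t∕n}·conj(e^{2πij t′∕n}) = [t = t′]·n`. -/
theorem sum_rootChar (n : ℕ) [NeZero n] (t t' : Fin n) :
    ∑ j : Fin n, rootChar n j t * conj (rootChar n j t') = if t = t' then (n : ℂ) else 0 := by
  have hn : (n : ℂ) ≠ 0 := Nat.cast_ne_zero.mpr (NeZero.ne n)
  have hterm : ∀ j : Fin n, rootChar n j t * conj (rootChar n j t') =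
      cexp (2 * π * I * (((t : ℕ) : ℤ) - ((t' : ℕ) : ℤ) : ℤ) / n) ^ (j : ℕ) := by
    intro j
    rw [conj_rootChar, rootChar_eq_pow, rootChar_eq_pow, ← div_eq_mul_inv, ← div_pow, ← Complex.exp_sub]
    congr 1
    push_cast
    ring
  simp_rw [hterm]
  rw [Fin.sum_univ_eq_sum_range (fun j => cexp (2 * π * I * (((t : ℕ) : ℤ) - ((t' : ℕ) : ℤ) : ℤ) / n) ^ j) n]
  by_cases h : t = t'
  · subst h
    rw [if_pos rfl, sub_self, Int.cast_zero, mul_zero, zero_div, Complex.exp_zero]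
    simp
  · rw [if_neg h]
    have hne : cexp (2 * π * I * (((t : ℕ) : ℤ) - ((t' : ℕ) : ℤ) : ℤ) / n) ≠ 1 := by
      intro h1
      have hr : -(n : ℤ) < ((t : ℕ) : ℤ) - ((t' : ℕ) : ℤ) ∧ ((t : ℕ) : ℤ) - ((t' : ℕ) : ℤ) < n := by
        have := t.isLt; have := t'.isLt; omega
      have := int_eq_zero_of_exp_eq_one n hr h1
      exact h (Fin.ext (by omega))
    rw [geom_sum_eq hne, ← Complex.exp_nat_mul]
    have : (n : ℂ) * (2 * π * I * ((((t : ℕ) : ℤ) - ((t' : ℕ) : ℤ) : ℤ) : ℂ) / n)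
        = ((((t : ℕ) : ℤ) - ((t' : ℕ) : ℤ) : ℤ) : ℂ) * (2 * π * I) := by
      field_simp
    rw [this, Complex.exp_int_mul_two_pi_mul_I, sub_self, zero_div]

/-- [folklore] The box character `chi n k τ = Π_ν e^{2πi k_ν τ_ν∕n}`. -/
def chi (n : ℕ) (k τ : Fin d → Fin n) : ℂ := ∏ ν, rootChar n (k ν) (τ ν)

/-- [folklore] **BOX ORTHOGONALITY**: `Σ_k chi k τ·conj(chi k τ′) = [τ = τ′]·n^d`. -/
theorem sum_chi_mul_conj_chi (n : ℕ) [NeZero n] (τ τ' : Fin d → Fin n) :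
    ∑ k : Fin d → Fin n, chi n k τ * conj (chi n k τ') = if τ = τ' then ((n : ℂ) ^ d) else 0 := by
  have hprod : ∀ k : Fin d → Fin n, chi n k τ * conj (chi n k τ') = ∏ ν, (rootChar n (k ν) (τ ν) * conj (rootChar n (k ν) (τ' ν))) := by
    intro k
    unfold chi
    rw [map_prod, ← Finset.prod_mul_distrib]
  simp_rw [hprod]
  have h := Finset.prod_univ_sum (fun _ : Fin d => (Finset.univ : Finset (Fin n)))
    (fun ν j => rootChar n j (τ ν) * conj (rootChar n j (τ' ν)))
  rw [Fintype.piFinset_univ] at h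
  rw [← h]
  simp_rw [sum_rootChar]
  by_cases hτ : τ = τ'
  · subst hτ
    simp
  · rw [if_neg hτ]
    obtain ⟨ν, hν⟩ := Function.ne_iff.mp hτ
    exact Finset.prod_eq_zero (Finset.mem_univ ν) (if_neg hν)

/-- [folklore] **PARSEVAL FOR THE BOX DFT**: `Σ_k ‖Σ_τ c τ·chi k τ‖² = n^d·Σ_τ ‖c τ‖²`. -/
theorem parseval_chi (n : ℕ) [NeZero n] (c : (Fin d → Fin n) → ℂ) :
    ∑ k : Fin d → Fin n, ‖∑ τ, c τ * chi n k τ‖ ^ 2 = (n : ℝ) ^ d * ∑ τ, ‖c τ‖ ^ 2 := by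
  -- work in ℂ: ‖z‖² = z·conj z
  have key : ∀ k : Fin d → Fin n, (∑ τ, c τ * chi n k τ) * conj (∑ τ, c τ * chi n k τ)
      = ∑ τ, ∑ τ', c τ * conj (c τ') * (chi n k τ * conj (chi n k τ')) := by
    intro k
    rw [map_sum, Finset.sum_mul_sum]
    refine Finset.sum_congr rfl fun τ _ => Finset.sum_congr rfl fun τ' _ => ?_
    rw [map_mul]; ring
  apply Complex.ofReal_injective
  push_cast
  simp_rw [← Complex.mul_conj']
  calc ∑ k : Fin d → Fin n, (∑ τ, c τ * chi n k τ) * conj (∑ τ, c τ * chi n k τ)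
      = ∑ k : Fin d → Fin n, ∑ τ, ∑ τ', c τ * conj (c τ') * (chi n k τ * conj (chi n k τ')) :=
        Finset.sum_congr rfl fun k _ => key k
    _ = ∑ τ : Fin d → Fin n, ∑ τ' : Fin d → Fin n, ∑ k : Fin d → Fin n, c τ * conj (c τ') * (chi n k τ * conj (chi n k τ')) := by
        rw [Finset.sum_comm]
        exact Finset.sum_congr rfl fun τ _ => Finset.sum_comm
    _ = ∑ τ : Fin d → Fin n, ∑ τ' : Fin d → Fin n, c τ * conj (c τ') * (if τ = τ' then ((n : ℂ) ^ d) else 0) := by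
        refine Finset.sum_congr rfl fun τ _ => Finset.sum_congr rfl fun τ' _ => ?_
        rw [← Finset.mul_sum, sum_chi_mul_conj_chi]
    _ = ∑ τ : Fin d → Fin n, c τ * conj (c τ) * ((n : ℂ) ^ d) := by
        refine Finset.sum_congr rfl fun τ _ => ?_
        simp_rw [mul_ite, mul_zero]
        rw [Finset.sum_ite_eq]
        simp
    _ = ((n : ℂ) ^ d) * ∑ τ : Fin d → Fin n, c τ * conj (c τ) := by
        rw [Finset.mul_sum]
        exact Finset.sum_congr rfl fun τ _ => by ring

/-- [folklore] `‖chi‖ = 1`. -/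
theorem norm_chi (n : ℕ) (k τ : Fin d → Fin n) : ‖chi n k τ‖ = 1 := by
  unfold chi
  rw [norm_prod]
  simp [norm_rootChar]

/-- [folklore] The `p′`-twist of the left phase: `EF n τ k p = (Π_ν e^{ip_ντ_ν∕n})·chi n k τ`. -/
theorem EF_eq_twist_mul_chi (n : ℕ) (τ k : Fin d → Fin n) (p : Fin d → ℂ) :
    EF n τ k p = (∏ ν, cexp (I * p ν * (τ ν : ℕ) / n)) * chi n k τ := by
  unfold EF chi
  rw [← Finset.prod_mul_distrib]
  refine Finset.prod_congr rfl fun ν _ => ?_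
  unfold ef rootChar
  rw [← Complex.exp_add]
  congr 1
  ring

/-- [folklore] The `p′`-twist of the right phase: `EFc n σ k p = (Π_ν e^{−ip_νσ_ν∕n})·conj(chi n k σ)`. -/
theorem EFc_eq_twist_mul_conj_chi (n : ℕ) (σ k : Fin d → Fin n) (p : Fin d → ℂ) :
    EFc n σ k p = (∏ ν, cexp (-(I * p ν * (σ ν : ℕ) / n))) * conj (chi n k σ) := by
  unfold EFc chi
  rw [map_prod, ← Finset.prod_mul_distrib]
  refine Finset.prod_congr rfl fun ν _ => ?_
  unfold efc
  rw [conj_rootChar, rootChar, ← Complex.exp_neg, ← Complex.exp_add]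
  congr 1
  ring

/-- [folklore] The twists are bounded by `2^d` on the fat region (`|Im p_ν| ≤ 1∕2`). -/
theorem norm_twist_le (n : ℕ) [NeZero n] (τ : Fin d → Fin n) {p : Fin d → ℂ} (hp : ∀ ν, |(p ν).im| ≤ 1 / 2) :
    ‖∏ ν, cexp (I * p ν * (τ ν : ℕ) / n)‖ ≤ 2 ^ d := by
  rw [norm_prod]
  calc ∏ ν, ‖cexp (I * p ν * (τ ν : ℕ) / n)‖ ≤ ∏ _ν : Fin d, (2 : ℝ) := Finset.prod_le_prod (fun _ _ => norm_nonneg _) (fun ν _ => by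
          have h := norm_ef_le n 0 (τ ν) (τ ν).isLt.le (hp ν)
          unfold ef at h
          simpa using h)
    _ = 2 ^ d := by simp

/-- [folklore] The conjugate twists are bounded by `2^d` on the fat region. -/
theorem norm_twistc_le (n : ℕ) [NeZero n] (σ : Fin d → Fin n) {p : Fin d → ℂ} (hp : ∀ ν, |(p ν).im| ≤ 1 / 2) :
    ‖∏ ν, cexp (-(I * p ν * (σ ν : ℕ) / n))‖ ≤ 2 ^ d := by
  rw [norm_prod]
  calc ∏ ν, ‖cexp (-(I * p ν * (σ ν : ℕ) / n))‖ ≤ ∏ _ν : Fin d, (2 : ℝ) := Finset.prod_le_prod (fun _ _ => norm_nonneg _) (fun ν _ => by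
          have h := norm_efc_le n 0 (σ ν) (σ ν).isLt.le (hp ν)
          unfold efc at h
          simpa using h)
    _ = 2 ^ d := by simp

/-- [folklore] The left twisted DFT `Adft f k p = Σ_τ conj(f τ)·EF n τ k p`. -/
def Adft (n : ℕ) (f : (Fin d → Fin n) → ℂ) (k : Fin d → Fin n) (p : Fin d → ℂ) : ℂ := ∑ τ, conj (f τ) * EF n τ k p

/-- [folklore] The right twisted DFT `Bdft g k p = Σ_σ g σ·EFc n σ k p`. -/
def Bdft (n : ℕ) (g : (Fin d → Fin n) → ℂ) (k : Fin d → Fin n) (p : Fin d → ℂ) : ℂ := ∑ σ, g σ * EFc n σ k p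

/-- [folklore] **`Σ_k ‖Adft f k p‖² ≤ n^d·4^d·sqNorm f`** on `|Im p_ν| ≤ 1∕2` (Parseval + the twist bound). -/
theorem sqNorm_Adft_le (n : ℕ) [NeZero n] (f : (Fin d → Fin n) → ℂ) {p : Fin d → ℂ} (hp : ∀ ν, |(p ν).im| ≤ 1 / 2) :
    sqNorm (fun k => Adft n f k p) ≤ (n : ℝ) ^ d * 4 ^ d * sqNorm f := by
  unfold sqNorm Adft
  have e : ∀ k, ∑ τ, conj (f τ) * EF n τ k p = ∑ τ, (conj (f τ) * ∏ ν, cexp (I * p ν * (τ ν : ℕ) / n)) * chi n k τ := fun k =>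
    Finset.sum_congr rfl fun τ _ => by rw [EF_eq_twist_mul_chi]; ring
  simp_rw [e]
  rw [parseval_chi]
  rw [mul_assoc]
  refine mul_le_mul_of_nonneg_left ?_ (by positivity)
  rw [Finset.mul_sum]
  refine Finset.sum_le_sum fun τ _ => ?_
  rw [norm_mul, mul_pow, Complex.norm_conj]
  have h := norm_twist_le n τ hp
  have h4 : ‖∏ ν, cexp (I * p ν * (τ ν : ℕ) / n)‖ ^ 2 ≤ 4 ^ d := by
    calc ‖∏ ν, cexp (I * p ν * (τ ν : ℕ) / n)‖ ^ 2 ≤ (2 ^ d) ^ 2 := pow_le_pow_left₀ (norm_nonneg _) h 2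
      _ = 4 ^ d := by rw [← pow_mul, mul_comm, pow_mul]; norm_num
  calc ‖f τ‖ ^ 2 * ‖∏ ν, cexp (I * p ν * (τ ν : ℕ) / n)‖ ^ 2 ≤ ‖f τ‖ ^ 2 * 4 ^ d := mul_le_mul_of_nonneg_left h4 (sq_nonneg _)
    _ = 4 ^ d * ‖f τ‖ ^ 2 := by ring

/-- [folklore] **`Σ_k ‖Bdft g k p‖² ≤ n^d·4^d·sqNorm g`** on `|Im p_ν| ≤ 1∕2`. -/
theorem sqNorm_Bdft_le (n : ℕ) [NeZero n] (g : (Fin d → Fin n) → ℂ) {p : Fin d → ℂ} (hp : ∀ ν, |(p ν).im| ≤ 1 / 2) :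
    sqNorm (fun k => Bdft n g k p) ≤ (n : ℝ) ^ d * 4 ^ d * sqNorm g := by
  unfold sqNorm Bdft
  -- conj(chi) instead of chi: take norms of conjugates
  have e : ∀ k, ‖∑ σ, g σ * EFc n σ k p‖ = ‖∑ σ, (conj (g σ) * ∏ ν, conj (cexp (-(I * p ν * (σ ν : ℕ) / n)))) * chi n k σ‖ := by
    intro k
    rw [← Complex.norm_conj, map_sum]
    congr 1
    refine Finset.sum_congr rfl fun σ _ => ?_
    rw [EFc_eq_twist_mul_conj_chi, map_mul, map_mul, Complex.conj_conj, map_prod]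
    ring
  simp_rw [e]
  rw [parseval_chi, mul_assoc]
  refine mul_le_mul_of_nonneg_left ?_ (by positivity)
  rw [Finset.mul_sum]
  refine Finset.sum_le_sum fun σ _ => ?_
  rw [norm_mul, mul_pow, Complex.norm_conj, ← map_prod, Complex.norm_conj]
  have h := norm_twistc_le n σ hp
  have h4 : ‖∏ ν, cexp (-(I * p ν * (σ ν : ℕ) / n))‖ ^ 2 ≤ 4 ^ d := by
    calc ‖∏ ν, cexp (-(I * p ν * (σ ν : ℕ) / n))‖ ^ 2 ≤ (2 ^ d) ^ 2 := pow_le_pow_left₀ (norm_nonneg _) h 2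
      _ = 4 ^ d := by rw [← pow_mul, mul_comm, pow_mul]; norm_num
  calc ‖g σ‖ ^ 2 * ‖∏ ν, cexp (-(I * p ν * (σ ν : ℕ) / n))‖ ^ 2 ≤ ‖g σ‖ ^ 2 * 4 ^ d := mul_le_mul_of_nonneg_left h4 (sq_nonneg _)
    _ = 4 ^ d * ‖g σ‖ ^ 2 := by ring

end Summit.QuantumFields.BalabanUV.Beta.FP.ConstrainedBiLaplacianParseval

end
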